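import Mathlib
import Summits.CriticalPhenomena.SAWScalingLimit.Theses.SAWTowerCount
import Summits.CriticalPhenomena.SAWScalingLimit.Theorems.SAWTowerCountPoissonKernelExpansionSeries

/-!
# Route SAWTowerCount · support `PoissonKernelExpansion` (item stmt-CriticalPhenomena-7258)

The level-two expansion of the `b`-th power of the Poisson excursion kernel of the rectangle
`(0,m) × (0,1)` between its two ends, in `q = e^{-π m}`, uniformly for `y, y' ∈ [η, 1-η]`:

`H_m(y,y')^b = (2 q sin πy sin πy')^b (1 + K₁ q + K₂ q²) + O(q^{b+3})`,
`K₁ = 8b cos πy cos πy'`, `K₂ = b(3(4cos²πy-1)(4cos²πy'-1)+1) + 32 b(b-1) cos²πy cos²πy'`.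

Proof: the series step (`poissonKernel_series_expansion`, file `…Series`) gives
`H = 2q s s'(1 + a₁ q + a₂ q²) + O(q⁴)` with `a₁ = 8 c c'`, `a₂ = 1 + 3(4c²-1)(4c'²-1)` after
`sin 2x = 2 sin x cos x`, `sin 3x = sin x (4cos²x - 1)`; dividing by `2 q s s' ≥ 2q(2η)²` gives
`H = 2qss'(1+u)` with `u = a₁q + a₂q² + O(q³)`, and the binomial expansion
`(1+u)^b = 1 + bu + b(b-1)/2 u² + O(u³)` (`one_add_rpow_taylor_two`) yields
`K₁ = b a₁`, `K₂ = b a₂ + b(b-1)/2 · a₁²`.  Sources: arXiv:1008.4321 (corridor kernel),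
doi:10.1016/0550-3213(86)90552-3 (finite-size expansion bookkeeping); the computation is elementary.
-/

namespace Summit.CriticalPhenomena.SAWScalingLimit.Theorems

open Real

/-- Trigonometric bookkeeping: the three leading terms of the kernel series rewritten through
`sin 2x = 2 sin x cos x` and `sin 3x = sin x (4 cos² x - 1)`. -/
theorem poissonKernel_main_trig (q y y' : ℝ) :
    2 * q * Real.sin (Real.pi * y) * Real.sin (Real.pi * y') * (1 + q ^ 2) +
        4 * q ^ 2 * Real.sin (2 * (Real.pi * y)) * Real.sin (2 * (Real.pi * y')) +
        6 * q ^ 3 * Real.sin (3 * (Real.pi * y)) * Real.sin (3 * (Real.pi * y')) =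
      2 * q * Real.sin (Real.pi * y) * Real.sin (Real.pi * y') *
        (1 + 8 * Real.cos (Real.pi * y) * Real.cos (Real.pi * y') * q +
          (1 + 3 * (4 * Real.cos (Real.pi * y) ^ 2 - 1) * (4 * Real.cos (Real.pi * y') ^ 2 - 1)) *
            q ^ 2) := by
  have h3 : ∀ x : ℝ, Real.sin (3 * x) = Real.sin x * (4 * Real.cos x ^ 2 - 1) := fun x => by
    rw [Real.sin_three_mul, Real.cos_sq']
    ring
  rw [Real.sin_two_mul, Real.sin_two_mul, h3, h3]
  ring

/-- **Item stmt-CriticalPhenomena-7258 · `PoissonKernelExpansion`** (route SAWTowerCount, support):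
for `b > 0`, `0 < η < 1/2` there are `C, m₀` with
`|H_m(y,y')^b - (2e^{-πm} sin πy sin πy')^b (1 + K₁ e^{-πm} + K₂ e^{-2πm})| ≤ C e^{-(b+3)πm}`
for all `m ≥ m₀` and `y, y' ∈ [η, 1-η]`, where `H_m(y,y') = Σ_{k≥1} k sin(kπy) sin(kπy')/sinh(kπm)`
is the Poisson excursion kernel between the ends of `(0,m)×(0,1)`, `K₁ = 8b cos πy cos πy'` and
`K₂ = b(3(4cos²πy-1)(4cos²πy'-1)+1) + 32b(b-1)cos²πy cos²πy'`. -/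
theorem poissonKernelExpansion_proof :
    Summit.CriticalPhenomena.SAWScalingLimit.Theses.SAWTowerCount.PoissonKernelExpansion := by
  intro b η hb hη hη2
  dsimp only
  -- Taylor data for `(1+u)^b`
  obtain ⟨Cb, δ, hδ, hCb⟩ := one_add_rpow_taylor_two b
  -- constants
  set σ : ℝ := 2 * η with hσ
  have hσ0 : 0 < σ := by positivity
  set A : ℝ := 36 + 32 / σ ^ 2 with hA
  set B : ℝ := 28 + 32 / σ ^ 2 with hB
  have hA0 : 0 < A := by positivity
  have hB0 : 0 < B := by positivity
  set δ' : ℝ := min δ (1 / 2) with hδ'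
  have hδ'0 : 0 < δ' := lt_min hδ (by norm_num)
  have hδ'δ : δ' ≤ δ := min_le_left _ _
  have hδ'h : δ' ≤ 1 / 2 := min_le_right _ _
  set C₁ : ℝ := |Cb| * A ^ 3 + b * (32 / σ ^ 2) + |b * (b - 1) / 2| * (B * (A + 8)) with hC₁
  refine ⟨(2 : ℝ) ^ b * C₁, max 1 (2 * A / δ'), ?_⟩
  intro m y y' hm hy1 hy2 hy1' hy2'
  have hm1 : 1 ≤ m := le_trans (le_max_left _ _) hm
  have hmA : 2 * A / δ' ≤ m := le_trans (le_max_right _ _) hm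
  have hpi3 := Real.pi_gt_three
  -- the two external inputs, stated before abbreviating
  have hRb := poissonKernel_series_expansion m y y' hm1
  rw [poissonKernel_main_trig] at hRb
  have hq4 : Real.exp (-Real.pi * m) ≤ 1 / 4 := exp_neg_pi_mul_le_quarter hm1
  have hq2 : Real.exp (-2 * Real.pi * m) = Real.exp (-Real.pi * m) ^ 2 := by
    rw [← Real.exp_nat_mul]; congr 1; push_cast; ring
  have hqb3 : Real.exp (-Real.pi * m) ^ b * Real.exp (-Real.pi * m) ^ 3 =
      Real.exp (-(b + 3) * Real.pi * m) := by
    rw [← Real.exp_mul, ← Real.exp_nat_mul, ← Real.exp_add]; congr 1; push_cast; ring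
  have hqm : Real.exp (-Real.pi * m) * m ≤ 1 := by
    have h1 := Real.add_one_le_exp (Real.pi * m)
    have h2 : Real.exp (-Real.pi * m) * Real.exp (Real.pi * m) = 1 := by
      rw [← Real.exp_add]; simp
    have h3 : m ≤ Real.exp (Real.pi * m) := by nlinarith
    calc Real.exp (-Real.pi * m) * m ≤ Real.exp (-Real.pi * m) * Real.exp (Real.pi * m) := by
          gcongr
      _ = 1 := h2
  rw [hq2]
  -- sines bounded below by σ = 2η, cosines by 1 (recorded before abstracting the atoms)
  have hsσ : σ ≤ Real.sin (Real.pi * y) := two_mul_le_sin_pi_mul hη.le hy1 hy2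
  have hsσ' : σ ≤ Real.sin (Real.pi * y') := two_mul_le_sin_pi_mul hη.le hy1' hy2'
  have hs1 : Real.sin (Real.pi * y) ≤ 1 := Real.sin_le_one _
  have hs1' : Real.sin (Real.pi * y') ≤ 1 := Real.sin_le_one _
  have hc1 : |Real.cos (Real.pi * y)| ≤ 1 := Real.abs_cos_le_one _
  have hc1' : |Real.cos (Real.pi * y')| ≤ 1 := Real.abs_cos_le_one _
  have hc2 : Real.cos (Real.pi * y) ^ 2 ≤ 1 := Real.cos_sq_le_one _
  have hc2' : Real.cos (Real.pi * y') ^ 2 ≤ 1 := Real.cos_sq_le_one _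
  have hq0 : 0 < Real.exp (-Real.pi * m) := Real.exp_pos _
  -- abstract the transcendental atoms: from here on everything is polynomial bookkeeping
  generalize (∑' k : ℕ, ((k : ℝ) + 1) * Real.sin (((k : ℝ) + 1) * Real.pi * y) *
      Real.sin (((k : ℝ) + 1) * Real.pi * y') / Real.sinh (((k : ℝ) + 1) * Real.pi * m)) = H
    at hRb ⊢
  generalize Real.exp (-Real.pi * m) = q at hq0 hq4 hqm hqb3 hRb ⊢
  generalize Real.sin (Real.pi * y) = s at hsσ hs1 hRb ⊢
  generalize Real.sin (Real.pi * y') = s' at hsσ' hs1' hRb ⊢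
  generalize Real.cos (Real.pi * y) = c at hc1 hc2 hRb ⊢
  generalize Real.cos (Real.pi * y') = c' at hc1' hc2' hRb ⊢
  have hqle1 : q ≤ 1 := by linarith only [hq4]
  have hs0 : 0 < s := lt_of_lt_of_le hσ0 hsσ
  have hs0' : 0 < s' := lt_of_lt_of_le hσ0 hsσ'
  have hqA : q * A ≤ δ' / 2 := by
    have h1 : 2 * A ≤ m * δ' := by rwa [div_le_iff₀ hδ'0] at hmA
    have h2 : q * (2 * A) ≤ q * (m * δ') := by gcongr
    nlinarith only [h2, hqm, hδ'0, hq0]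
  -- the prefactor P = 2 q s s'
  obtain ⟨P, hP⟩ : ∃ P : ℝ, P = 2 * q * s * s' := ⟨_, rfl⟩
  rw [← hP] at hRb ⊢
  have hP0 : 0 < P := by rw [hP]; positivity
  have hPσ : 2 * q * σ ^ 2 ≤ P := by
    calc 2 * q * σ ^ 2 = 2 * q * (σ * σ) := by ring
      _ ≤ 2 * q * (s * s') := by gcongr
      _ = P := by rw [hP]; ring
  have hP2q : P ≤ 2 * q := by
    calc P = 2 * q * (s * s') := by rw [hP]; ring
      _ ≤ 2 * q * (1 * 1) := by gcongr
      _ = 2 * q := by ring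
  -- the two b-independent kernels
  obtain ⟨a₁, ha₁⟩ : ∃ a₁ : ℝ, a₁ = 8 * c * c' := ⟨_, rfl⟩
  obtain ⟨a₂, ha₂⟩ : ∃ a₂ : ℝ, a₂ = 1 + 3 * (4 * c ^ 2 - 1) * (4 * c' ^ 2 - 1) := ⟨_, rfl⟩
  rw [← ha₁, ← ha₂] at hRb
  have ha₁b : |a₁| ≤ 8 := by
    rw [ha₁, abs_mul, abs_mul, show |(8 : ℝ)| = 8 by norm_num]
    calc 8 * |c| * |c'| ≤ 8 * 1 * 1 := by gcongr
      _ = 8 := by ring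
  have h4c : |4 * c ^ 2 - 1| ≤ 3 :=
    abs_le.mpr ⟨by linarith only [sq_nonneg c], by linarith only [hc2]⟩
  have h4c' : |4 * c' ^ 2 - 1| ≤ 3 :=
    abs_le.mpr ⟨by linarith only [sq_nonneg c'], by linarith only [hc2']⟩
  have ha₂b : |a₂| ≤ 28 := by
    rw [ha₂]
    calc |1 + 3 * (4 * c ^ 2 - 1) * (4 * c' ^ 2 - 1)| ≤
          |(1 : ℝ)| + |3 * (4 * c ^ 2 - 1) * (4 * c' ^ 2 - 1)| := abs_add_le _ _
      _ = 1 + 3 * |4 * c ^ 2 - 1| * |4 * c' ^ 2 - 1| := by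
          rw [abs_one, abs_mul, abs_mul, show |(3 : ℝ)| = 3 by norm_num]
      _ ≤ 1 + 3 * 3 * 3 := by gcongr
      _ = 28 := by norm_num
  -- remainder of the series step and the relative correction u
  obtain ⟨R, hR⟩ : ∃ R : ℝ, R = H - P * (1 + a₁ * q + a₂ * q ^ 2) := ⟨_, rfl⟩
  rw [← hR] at hRb
  obtain ⟨u, hu⟩ : ∃ u : ℝ, u = a₁ * q + a₂ * q ^ 2 + R / P := ⟨_, rfl⟩
  have hHu : H = P * (1 + u) := by
    rw [hu, hR]
    field_simp
    ring
  have hRP : |R / P| ≤ 32 * q ^ 3 / σ ^ 2 := by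
    rw [abs_div, abs_of_pos hP0, div_le_iff₀ hP0]
    calc |R| ≤ 64 * q ^ 4 := hRb
      _ = 32 * q ^ 3 / σ ^ 2 * (2 * q * σ ^ 2) := by field_simp; ring
      _ ≤ 32 * q ^ 3 / σ ^ 2 * P := by gcongr
  have hq32 : q ^ 3 ≤ q ^ 2 := pow_le_pow_of_le_one hq0.le hqle1 (by norm_num)
  have hq21 : q ^ 2 ≤ q := pow_le_of_le_one hq0.le hqle1 two_ne_zero
  have hq31 : q ^ 3 ≤ q := hq32.trans hq21
  have hub : |u| ≤ q * A := by
    calc |u| ≤ |a₁ * q| + |a₂ * q ^ 2| + |R / P| := by rw [hu]; exact abs_add_three _ _ _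
      _ = |a₁| * q + |a₂| * q ^ 2 + |R / P| := by
          rw [abs_mul, abs_mul, abs_of_pos hq0, abs_of_pos (by positivity : (0 : ℝ) < q ^ 2)]
      _ ≤ 8 * q + 28 * q ^ 2 + 32 * q ^ 3 / σ ^ 2 := by gcongr
      _ ≤ 8 * q + 28 * q + 32 * q / σ ^ 2 := by gcongr
      _ = q * A := by rw [hA]; ring
  have huδ' : |u| < δ' := by linarith only [hub, hqA, hδ'0]
  have huδ : |u| < δ := lt_of_lt_of_le huδ' hδ'δ
  have hu_half : |u| < 1 / 2 := lt_of_lt_of_le huδ' hδ'h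
  have h1u : 0 < 1 + u := by
    have := (abs_lt.mp hu_half).1
    linarith only [this]
  -- the binomial (Taylor) remainder
  have hT : |(1 + u) ^ b - (1 + b * u + b * (b - 1) / 2 * u ^ 2)| ≤ |Cb| * A ^ 3 * q ^ 3 := by
    refine (hCb u huδ).trans ?_
    calc Cb * |u| ^ 3 ≤ |Cb| * |u| ^ 3 :=
          mul_le_mul_of_nonneg_right (le_abs_self Cb) (by positivity)
      _ ≤ |Cb| * (q * A) ^ 3 := by gcongr
      _ = |Cb| * A ^ 3 * q ^ 3 := by ring
  -- the polynomial remainder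
  have hw : |u ^ 2 - a₁ ^ 2 * q ^ 2| ≤ B * (A + 8) * q ^ 3 := by
    have hid : u ^ 2 - a₁ ^ 2 * q ^ 2 = (a₂ * q ^ 2 + R / P) * (u + a₁ * q) := by
      rw [hu]; ring
    rw [hid, abs_mul]
    have h1 : |a₂ * q ^ 2 + R / P| ≤ B * q ^ 2 := by
      calc |a₂ * q ^ 2 + R / P| ≤ |a₂ * q ^ 2| + |R / P| := abs_add_le _ _
        _ = |a₂| * q ^ 2 + |R / P| := by
            rw [abs_mul, abs_of_pos (by positivity : (0 : ℝ) < q ^ 2)]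
        _ ≤ 28 * q ^ 2 + 32 * q ^ 3 / σ ^ 2 := by gcongr
        _ ≤ 28 * q ^ 2 + 32 * q ^ 2 / σ ^ 2 := by gcongr
        _ = B * q ^ 2 := by rw [hB]; ring
    have h2 : |u + a₁ * q| ≤ (A + 8) * q := by
      calc |u + a₁ * q| ≤ |u| + |a₁ * q| := abs_add_le _ _
        _ = |u| + |a₁| * q := by rw [abs_mul, abs_of_pos hq0]
        _ ≤ q * A + 8 * q := by gcongr
        _ = (A + 8) * q := by ring
    calc |a₂ * q ^ 2 + R / P| * |u + a₁ * q| ≤ (B * q ^ 2) * ((A + 8) * q) :=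
          mul_le_mul h1 h2 (abs_nonneg _) (by positivity)
      _ = B * (A + 8) * q ^ 3 := by ring
  -- total relative remainder
  have hE : |(1 + u) ^ b - (1 + 8 * b * c * c' * q +
      (b * (3 * (4 * c ^ 2 - 1) * (4 * c' ^ 2 - 1) + 1) + 32 * b * (b - 1) * c ^ 2 * c' ^ 2) *
        q ^ 2)| ≤ C₁ * q ^ 3 := by
    have hsplit : (1 + u) ^ b - (1 + 8 * b * c * c' * q +
        (b * (3 * (4 * c ^ 2 - 1) * (4 * c' ^ 2 - 1) + 1) + 32 * b * (b - 1) * c ^ 2 * c' ^ 2) *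
          q ^ 2) =
        ((1 + u) ^ b - (1 + b * u + b * (b - 1) / 2 * u ^ 2)) +
          (b * (R / P) + b * (b - 1) / 2 * (u ^ 2 - a₁ ^ 2 * q ^ 2)) := by
      have hu' : b * u = b * (a₁ * q + a₂ * q ^ 2 + R / P) := by rw [hu]
      rw [ha₁, ha₂] at hu'
      rw [ha₁]
      linear_combination hu'
    rw [hsplit]
    calc |((1 + u) ^ b - (1 + b * u + b * (b - 1) / 2 * u ^ 2)) +
            (b * (R / P) + b * (b - 1) / 2 * (u ^ 2 - a₁ ^ 2 * q ^ 2))|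
        ≤ |(1 + u) ^ b - (1 + b * u + b * (b - 1) / 2 * u ^ 2)| +
            |b * (R / P) + b * (b - 1) / 2 * (u ^ 2 - a₁ ^ 2 * q ^ 2)| := abs_add_le _ _
      _ ≤ |(1 + u) ^ b - (1 + b * u + b * (b - 1) / 2 * u ^ 2)| +
            (|b * (R / P)| + |b * (b - 1) / 2 * (u ^ 2 - a₁ ^ 2 * q ^ 2)|) := by
          gcongr; exact abs_add_le _ _
      _ = |(1 + u) ^ b - (1 + b * u + b * (b - 1) / 2 * u ^ 2)| +
            (b * |R / P| + |b * (b - 1) / 2| * |u ^ 2 - a₁ ^ 2 * q ^ 2|) := by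
          rw [abs_mul, abs_mul, abs_of_pos hb]
      _ ≤ |Cb| * A ^ 3 * q ^ 3 + (b * (32 * q ^ 3 / σ ^ 2) +
            |b * (b - 1) / 2| * (B * (A + 8) * q ^ 3)) := by gcongr
      _ = C₁ * q ^ 3 := by rw [hC₁]; ring
  -- assemble
  have hHb : H ^ b = P ^ b * (1 + u) ^ b := by
    rw [hHu]; exact Real.mul_rpow hP0.le h1u.le
  have hPb : P ^ b ≤ (2 : ℝ) ^ b * q ^ b := by
    calc P ^ b ≤ (2 * q) ^ b := Real.rpow_le_rpow hP0.le hP2q hb.le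
      _ = 2 ^ b * q ^ b := Real.mul_rpow (by norm_num) hq0.le
  rw [hHb, ← mul_sub, abs_mul, abs_of_pos (Real.rpow_pos_of_pos hP0 b)]
  calc P ^ b * |(1 + u) ^ b - (1 + 8 * b * c * c' * q +
        (b * (3 * (4 * c ^ 2 - 1) * (4 * c' ^ 2 - 1) + 1) + 32 * b * (b - 1) * c ^ 2 * c' ^ 2) *
          q ^ 2)| ≤ ((2 : ℝ) ^ b * q ^ b) * (C₁ * q ^ 3) :=
        mul_le_mul hPb hE (abs_nonneg _) (by positivity)
    _ = (2 : ℝ) ^ b * C₁ * (q ^ b * q ^ 3) := by ring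
    _ = (2 : ℝ) ^ b * C₁ * Real.exp (-(b + 3) * Real.pi * m) := by rw [hqb3]

end Summit.CriticalPhenomena.SAWScalingLimit.Theorems
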